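import Mathlib.Algebra.Module.CharacterModule
import Literature.NumberTheory.IwasawaTheory.Greenberg2016.GlobalToLocalSurjectivity
import HarnessLib

/-!
# Greenberg 2010 §2 (p. 7, p. 13): the Pontryagin dual of a DIVISIBLE `Λ`-module is TORSION-FREE
# — and conversely — in the `IsDualPairing` idiom of `Greenberg2016/SelmerGroupStructure.lean`
# (theorems only; no definition, no named fact)

Topic `NumberTheory/IwasawaTheory/Greenberg2016`; namespace
`Literature.NumberTheory.IwasawaTheory.Greenberg2016`. Seat `bsd-line-x1-p1-w5` gen 9 (cell `bsd-eis`,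
crux 2 `GoodLatticeBDPValue` = stmt-BirchSwinnertonDyer-19032), brick A1 of the road memo «SUR-Λ»
(evidence #41 on that item): the first algebraic input of an in-tree proof of the by-name input
`Greenberg2016.prop263_sur_of_crk` (Greenberg 2016 Prop. 2.6.3 = Greenberg 2010 Prop. 3.2.1).

PRINT. R. Greenberg, *Surjectivity of the global-to-local map defining a Selmer group*, Kyoto J.
Math. 50 (2010), §2: p. 7 L28–32 (proof of Prop. 2.1.1) "The first assumption [`D` is a divisible
`Λ`-module] means that `T*` is a torsion-free `Λ`-module"; p. 13 L36–38 (proof of Prop. 2.3.2) "Now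
`L(K_η, T*)` is the Pontryagin dual of the divisible `Λ`-module `Q_𝓛(K_η, D)` and is therefore a
torsion-free `Λ`-submodule of `H¹(K_η, T*)`"; p. 6 L20–28: "`L(K_v, T*)` [is] the orthogonal
complement of `L(K_v, D)` under the pairing (5) … isomorphic to the Pontryagin dual of the discrete
`Λ`-module `Q_𝓛(K_v, D) = H¹(K_v, D)/L(K_v, D)`"; p. 7 L3–4: "we let `A_{Λ-div}` denote the
maximal `Λ`-divisible submodule of `A`" (divisible = `θA = A` for every nonzero `θ ∈ Λ`, the tree's
`Greenberg2016.IsDivisible`).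

WHAT IS TYPED (dictionary (G2) of `SelmerGroupStructure.lean`: a Pontryagin dual is ANY datum
`toDual : X →+ (S →+ C)` with `IsDualPairing Λ S toDual`; `C` arbitrary, so the statements apply to
`ℚ/ℤ`-duals and to Tate duals `T* = Hom(D, μ_{p^∞})` alike):

* `IsDualPairing.eq_zero_of_forall_apply` — a dual element vanishing on `S` is zero.
* `IsDivisible.smul_eq_zero_iff` / `IsDivisible.isTorsionFree_dual` / `….torsion_dual_eq_bot` —
  **the dual of a divisible module is torsion-free**: `θ • x = 0`, `θ ≠ 0` forces `x = 0` (p. 7 L28–32).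
* `IsDivisible.eq_zero_of_forall_mem_apply_eq_zero_of_smul_eq_zero` — **the ORTHOGONAL COMPLEMENT of
  a submodule `N ≤ H` inside a dual of `H` is torsion-free as soon as `H ⧸ N` is divisible**
  (p. 13 L36–38 with p. 6 L20–28: `L(K_η, T*) = L(K_η, D)^⊥` and `Q_𝓛 = H¹/L` divisible) — the shape
  used by Prop. 2.3.2, with no quotient-dual datum to construct.
* `IsDivisible.of_surjective` / `IsDivisible.quotient` — images and quotients of divisible modules
  are divisible (p. 14 L1–2: "the image of `H¹(K_v, D)_{Λ-div}` in `Q_𝓛(K_v, D)` is … divisible").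
* §6 (appended, brick C4) `eq_zero_of_orthogonal_of_endo_eq_zero_of_quotient_divisible` /
  `IsDivisible.eq_zero_of_orthogonal_of_endo_eq_zero` — the PAIRING FORM of §3 (no dual datum: any
  bi-additive right-perfect pairing `P : H × Y → C` balanced for `θ` against an endomorphism `e` of `Y`),
  which is how Prop. 2.3.2 is consumed on the road («`y ∈ L_v^⊥`, `θ̂ y = 0`, `Q_𝓛(K_v,D)` divisible ⇒ `y = 0`»).
* `isDivisible_of_dual_torsionFree` — the CONVERSE for the character module `Hom(S, ℚ/ℤ)`: if some
  `ℚ/ℤ`-dual of `S` is torsion-free then `S` is divisible (`ℚ/ℤ` is an injective cogenerator: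
  Mathlib `CharacterModule.exists_character_apply_ne_zero_of_ne_zero`), so that for discrete
  `Λ`-modules "divisible" and "dual torsion-free" are the same property (p. 7 L28: "means").

RELATED IN THE TREE (not duplicated): `Literature.NumberTheory.EllipticCurves.CharacterDual.torsion_eq_bot_of_divisible`
(`CharacterModuleTorsionDivisibleProdProofs.lean`) proves `torsion_R(𝒟^∨) = ⊥` for Mathlib's
`CharacterModule 𝒟` under `R⁰`-divisibility; the present file works in the dictionary's idiom (ANY dual
datum, ANY value group — needed for `T* = Hom(D, μ_{p^∞})` — and `Greenberg2016.IsDivisible`), adds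
the orthogonal-complement form used by Prop. 2.3.2 and the converse.

HONEST FRAMING: elementary module algebra (no Galois cohomology); a helper toward the kernel
discharge of `prop263_sur_of_crk`, which this file does not prove; nothing summit-side, no case of
BSD. AI-typed, kernel-checked.

## References
* [Greenberg2010] R. Greenberg, Kyoto J. Math. 50 (2010) 853–888, doi:10.1215/0023608x-2010-016 —
  §2 p. 6 L20–28, p. 7 L3–4 and L28–32 (Prop. 2.1.1), p. 13 L26–38 (Prop. 2.3.2), p. 14 L1–2.
* [Greenberg2016Selmer] R. Greenberg, *On the structure of Selmer groups*, PROMS 188 (2016) —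
  §1 p. 2 (Pontryagin duals), §2.5 p. 8 (divisible specifications).
-/

noncomputable section

open scoped Classical

universe u

namespace Literature.NumberTheory.IwasawaTheory.Greenberg2016

variable {Λ : Type u} [CommRing Λ]

/-! ### §1. Dual elements are determined by their values -/

section Values

variable {S : Type u} [AddCommGroup S] [Module Λ S] {C : Type*} [AddCommGroup C]
  {X : Type u} [AddCommGroup X] [Module Λ X] {toDual : X →+ (S →+ C)}

/-- A dual element vanishing on every `s ∈ S` is zero (injectivity of the dual datum).
[cite: Greenberg2016Selmer, §1 p. 2 L17–35] -/
theorem IsDualPairing.eq_zero_of_forall_apply (h : IsDualPairing Λ S toDual) {x : X}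
    (hx : ∀ s : S, toDual x s = 0) : x = 0 :=
  h.injective (by ext s; rw [hx s, map_zero, AddMonoidHom.zero_apply])

/-- The value of `θ • x` at `s` is the value of `x` at `θ • s` (the `Λ`-balance of a dual datum,
restated with the scalar on the right for rewriting). [cite: Greenberg2016Selmer, §1 p. 2 L17–35] -/
theorem IsDualPairing.smul_apply (h : IsDualPairing Λ S toDual) (θ : Λ) (x : X) (s : S) :
    toDual (θ • x) s = toDual x (θ • s) :=
  h.map_smul θ x s

end Values

/-! ### §2. The dual of a divisible module is torsion-free (Greenberg 2010 p. 7 L28–32) -/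

section TorsionFree

variable {S : Type u} [AddCommGroup S] [Module Λ S] {C : Type*} [AddCommGroup C]
  {X : Type u} [AddCommGroup X] [Module Λ X] {toDual : X →+ (S →+ C)}

/-- **The Pontryagin dual of a divisible `Λ`-module is torsion-free**: if `θS = S` for every
nonzero `θ` and `X = Hom(S, C)` with the induced `Λ`-structure, then `θ • x = 0` with `θ ≠ 0`
forces `x = 0` ("The first assumption means that `T*` is a torsion-free `Λ`-module").
[cite: Greenberg2010, §2 p. 7 L28–32 (proof of Prop. 2.1.1)] -/
theorem IsDivisible.eq_zero_of_smul_eq_zero (hS : IsDivisible Λ S) (h : IsDualPairing Λ S toDual)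
    {θ : Λ} (hθ : θ ≠ 0) {x : X} (hx : θ • x = 0) : x = 0 := by
  refine h.eq_zero_of_forall_apply fun s ↦ ?_
  obtain ⟨t, rfl⟩ := hS θ hθ s
  rw [← h.smul_apply, hx, map_zero, AddMonoidHom.zero_apply]

/-- `θ • x = 0 ↔ x = 0` on the dual of a divisible module, for `θ ≠ 0`.
[cite: Greenberg2010, §2 p. 7 L28–32 (proof of Prop. 2.1.1)] -/
theorem IsDivisible.smul_eq_zero_iff (hS : IsDivisible Λ S) (h : IsDualPairing Λ S toDual)
    {θ : Λ} (hθ : θ ≠ 0) (x : X) : θ • x = 0 ↔ x = 0 :=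
  ⟨hS.eq_zero_of_smul_eq_zero h hθ, fun hx ↦ by rw [hx, smul_zero]⟩

/-- The dual of a divisible module is torsion-free in Mathlib's sense (`Module.IsTorsionFree Λ X`:
regular scalars act injectively). [cite: Greenberg2010, §2 p. 7 L28–32 (proof of Prop. 2.1.1)] -/
theorem IsDivisible.isTorsionFree_dual [Nontrivial Λ] (hS : IsDivisible Λ S)
    (h : IsDualPairing Λ S toDual) : Module.IsTorsionFree Λ X :=
  Module.IsTorsionFree.of_smul_eq_zero fun θ x hx ↦ by
    by_cases hθ : θ = 0
    · exact Or.inl hθ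
    · exact Or.inr (hS.eq_zero_of_smul_eq_zero h hθ hx)

/-- Torsion-submodule form: for a domain `Λ`, the `Λ`-torsion submodule of the dual of a divisible
module is `⊥` ("`X_{Λ-tors}`", Greenberg 2010 p. 7 L2).
[cite: Greenberg2010, §2 p. 7 L1–4 and L28–32] -/
theorem IsDivisible.torsion_dual_eq_bot [IsDomain Λ] (hS : IsDivisible Λ S)
    (h : IsDualPairing Λ S toDual) : Submodule.torsion Λ X = ⊥ := by
  haveI := hS.isTorsionFree_dual h
  exact Submodule.isTorsionFree_iff_torsion_eq_bot.1 ‹_›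

end TorsionFree

/-! ### §3. Orthogonal complements: `L(K_η, T*) = Q_𝓛(K_η, D)^∨` is torsion-free when `Q_𝓛` is
divisible (Greenberg 2010 p. 13 L36–38) -/

section Orthogonal

variable {H : Type u} [AddCommGroup H] [Module Λ H] {C : Type*} [AddCommGroup C]
  {X : Type u} [AddCommGroup X] [Module Λ X] {toDual : X →+ (H →+ C)}

/-- **The orthogonal complement `N^⊥` of a submodule `N ≤ H` in a dual of `H` is torsion-free when
`H ⧸ N` is divisible**: if `x ∈ X = Hom(H, C)` vanishes on `N`, `θ ≠ 0` and `θ • x = 0`, then `x = 0`.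
(Print: `L(K_η, T*) = L(K_η, D)^⊥` "is the Pontryagin dual of the divisible `Λ`-module `Q_𝓛(K_η, D)`
and is therefore a torsion-free `Λ`-submodule of `H¹(K_η, T*)`".)  Proof: every `s ∈ H` is
`θ • t + n` with `n ∈ N`, and `x(θ • t) = (θ • x)(t) = 0`.
[cite: Greenberg2010, §2 p. 13 L36–38 (proof of Prop. 2.3.2) and p. 6 L20–28] -/
theorem IsDivisible.eq_zero_of_forall_mem_apply_eq_zero_of_smul_eq_zero (N : Submodule Λ H)
    (hQ : IsDivisible Λ (H ⧸ N)) (h : IsDualPairing Λ H toDual) {x : X}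
    (hxN : ∀ n ∈ N, toDual x n = 0) {θ : Λ} (hθ : θ ≠ 0) (hx : θ • x = 0) : x = 0 := by
  refine h.eq_zero_of_forall_apply fun s ↦ ?_
  obtain ⟨t, ht⟩ := hQ θ hθ (Submodule.Quotient.mk s)
  obtain ⟨t, rfl⟩ := Submodule.Quotient.mk_surjective N t
  rw [← Submodule.Quotient.mk_smul, Submodule.Quotient.eq] at ht
  -- `s = θ • t - (θ • t - s)` with `θ • t - s ∈ N`
  have hs : s = θ • t - (θ • t - s) := by abel
  rw [hs, map_sub, hxN _ ht, sub_zero, ← h.smul_apply, hx, map_zero, AddMonoidHom.zero_apply]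

/-- The same with the complement given as the `Λ`-submodule `{x | ∀ n ∈ N, x(n) = 0}` of the dual:
it meets the `θ`-torsion trivially. [cite: Greenberg2010, §2 p. 13 L36–38 (proof of Prop. 2.3.2)] -/
theorem IsDivisible.forall_orthogonal_smul_eq_zero_imp (N : Submodule Λ H)
    (hQ : IsDivisible Λ (H ⧸ N)) (h : IsDualPairing Λ H toDual) {θ : Λ} (hθ : θ ≠ 0) :
    ∀ x : X, (∀ n ∈ N, toDual x n = 0) → θ • x = 0 → x = 0 :=
  fun _ hxN hx ↦ hQ.eq_zero_of_forall_mem_apply_eq_zero_of_smul_eq_zero N h hxN hθ hx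

end Orthogonal

/-! ### §4. Images and quotients of divisible modules are divisible (Greenberg 2010 p. 14 L1–2) -/

section Transfer

variable {M : Type u} [AddCommGroup M] [Module Λ M] {M' : Type u} [AddCommGroup M'] [Module Λ M']

/-- **A surjective `Λ`-linear image of a divisible module is divisible.**
[cite: Greenberg2010, §2 p. 14 L1–2] -/
theorem IsDivisible.of_surjective (hM : IsDivisible Λ M) (f : M →ₗ[Λ] M')
    (hf : Function.Surjective f) : IsDivisible Λ M' := by
  intro θ hθ s
  obtain ⟨m, rfl⟩ := hf s
  obtain ⟨t, rfl⟩ := hM θ hθ m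
  exact ⟨f t, (f.map_smul θ t).symm⟩

/-- **A quotient of a divisible module is divisible** (e.g. `Q_𝓛(K_v, D) = H¹(K_v, D)/L(K_v, D)`
when `H¹(K_v, D)` is divisible, Greenberg 2010 Remark 2.3.3). [cite: Greenberg2010, §2 p. 13 L40–42 and p. 14 L1–5] -/
theorem IsDivisible.quotient (hM : IsDivisible Λ M) (N : Submodule Λ M) : IsDivisible Λ (M ⧸ N) :=
  hM.of_surjective N.mkQ (Submodule.mkQ_surjective N)

/-- Divisibility transports along a `Λ`-linear equivalence. [cite: Greenberg2010, §2 p. 7 L3–4] -/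
theorem IsDivisible.of_linearEquiv (hM : IsDivisible Λ M) (e : M ≃ₗ[Λ] M') : IsDivisible Λ M' :=
  hM.of_surjective e.toLinearMap e.surjective

/-- Divisibility only asks for NONZERO `θ`; for the domain `ℤ_p⟦T⟧`-type rings of the setting it is
equivalent to ask it for every non-zero-divisor (restatement for consumers quantifying over `Λ⁰`).
[cite: Greenberg2010, §2 p. 7 L3–4] -/
theorem IsDivisible.exists_smul_eq_of_mem_nonZeroDivisors [Nontrivial Λ] (hM : IsDivisible Λ M)
    {θ : Λ} (hθ : θ ∈ nonZeroDivisors Λ) (s : M) : ∃ t : M, θ • t = s :=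
  hM θ (nonZeroDivisors.ne_zero hθ) s

end Transfer

/-! ### §5. Converse: a module with a torsion-free `ℚ/ℤ`-dual is divisible -/

section Converse

variable {S : Type u} [AddCommGroup S] [Module Λ S]
  {X : Type u} [AddCommGroup X] [Module Λ X] {toDual : X →+ (S →+ AddCircle (1 : ℚ))}

/-- **Converse: if a Pontryagin (`ℚ/ℤ`-valued) dual of `S` is torsion-free, then `S` is divisible.**
If `s ∉ θS`, a character of `S ⧸ θS` not vanishing at `s̄` (`ℚ/ℤ` is an injective cogenerator)
pulls back to a nonzero `x ∈ X` with `θ • x = 0`.  So for discrete `Λ`-modules "divisible" and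
"Pontryagin dual torsion-free" are equivalent (Greenberg: the assumption `D` divisible "means" that
`T*` is torsion-free). [cite: Greenberg2010, §2 p. 7 L28–32] -/
theorem isDivisible_of_dual_torsionFree (h : IsDualPairing Λ S toDual)
    (htf : ∀ θ : Λ, θ ≠ 0 → ∀ x : X, θ • x = 0 → x = 0) : IsDivisible Λ S := by
  intro θ hθ s
  by_contra hs
  push Not at hs
  -- the range of multiplication by `θ`, a `Λ`-submodule not containing `s`
  let N : Submodule Λ S := LinearMap.range (DistribSMul.toLinearMap Λ S θ)
  have hsN : Submodule.Quotient.mk (p := N) s ≠ 0 := by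
    intro h0
    rw [Submodule.Quotient.mk_eq_zero] at h0
    obtain ⟨t, ht⟩ := LinearMap.mem_range.1 h0
    exact hs t ht
  obtain ⟨c, hc⟩ := CharacterModule.exists_character_apply_ne_zero_of_ne_zero hsN
  -- the character `χ = c ∘ mk` of `S`, and its preimage `x` in the dual datum
  let χ : S →+ AddCircle (1 : ℚ) := (c : S ⧸ N →+ AddCircle (1 : ℚ)).comp N.mkQ.toAddMonoidHom
  obtain ⟨x, hx⟩ := h.bijective.2 χ
  have hθx : θ • x = 0 := by
    refine h.eq_zero_of_forall_apply fun q ↦ ?_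
    rw [h.smul_apply, hx]
    change c (Submodule.Quotient.mk (θ • q)) = 0
    have hmem : θ • q ∈ N := LinearMap.mem_range.2 ⟨q, rfl⟩
    rw [(Submodule.Quotient.mk_eq_zero N).2 hmem, map_zero]
  have hx0 : x = 0 := htf θ hθ x hθx
  apply hc
  have : χ s = 0 := by rw [← hx, hx0, map_zero, AddMonoidHom.zero_apply]
  exact this

/-- The equivalence for the character module `Hom(S, ℚ/ℤ)` itself (`isDualPairing_characterModule`
pattern: the identity datum): `S` is divisible iff its character module is torsion-free.
[cite: Greenberg2010, §2 p. 7 L28–32] -/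
theorem isDivisible_iff_characterModule_torsionFree :
    IsDivisible Λ S ↔
      ∀ θ : Λ, θ ≠ 0 → ∀ c : CharacterModule S, θ • c = 0 → c = 0 := by
  have hid : IsDualPairing Λ S (AddMonoidHom.id (CharacterModule S) :
      CharacterModule S →+ (S →+ AddCircle (1 : ℚ))) :=
    ⟨Function.bijective_id, fun _ _ _ ↦ rfl⟩
  exact ⟨fun hS θ hθ c hc ↦ hS.eq_zero_of_smul_eq_zero hid hθ hc,
    fun h ↦ isDivisible_of_dual_torsionFree hid h⟩

end Converse

/-! ### §6. Pairing form (no dual datum): right-perfect `Λ`-balanced pairings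
(appended 2026-08-29, brick C4 of the road «SUR-Λ»; Greenberg 2010 p. 13, proof of Prop. 2.3.2) -/

section Pairing

variable {H : Type u} [AddCommGroup H] [Module Λ H] {Y : Type*} [AddCommGroup Y]
  {C : Type*} [AddCommGroup C]

/-- **Prop. 2.3.2's local step, pairing form.** Let `P : H × Y → C` be bi-additive ("the local pairing
(5) `H¹(K_v, D) × H¹(K_v, T*) → ℚ_p/ℤ_p`"), RIGHT-perfect (`(∀ t, P t y = 0) → y = 0`), and
`Λ`-balanced for the scalar `θ` against an additive endomorphism `e` of `Y` (`P (θ • t) y = P t (e y)`,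
"`⟨λα, β⟩_v = ⟨α, λβ⟩_v`", p. 6 L18–20).  If `N ≤ H` has `θ`-divisible quotient `H ⧸ N` (only this one
`θ` is used), then every `y` ORTHOGONAL to `N` (`y ∈ N^⊥ = L(K_η, T*)`) and killed by `e` (`θ`-torsion)
is zero: `t = θ • t' + n` gives `P t y = P t' (e y) + P n y = 0` for all `t`.  ("`L(K_η, T*)` is the
Pontryagin dual of the divisible `Λ`-module `Q_𝓛(K_η, D)` and is therefore … torsion-free".)
[cite: Greenberg2010, §2.3 p. 13 L36–38 (proof of Prop. 2.3.2); §2 p. 6 L18–28] -/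
theorem eq_zero_of_orthogonal_of_endo_eq_zero_of_quotient_divisible (P : H →+ Y →+ C)
    (hperf : ∀ y : Y, (∀ t : H, P t y = 0) → y = 0) (θ : Λ) (e : Y →+ Y)
    (hbal : ∀ (t : H) (y : Y), P (θ • t) y = P t (e y)) (N : Submodule Λ H)
    (hdiv : ∀ q : H ⧸ N, ∃ q' : H ⧸ N, θ • q' = q) {y : Y}
    (hyN : ∀ n ∈ N, P n y = 0) (hy : e y = 0) : y = 0 := by
  refine hperf y fun t ↦ ?_
  obtain ⟨q', hq'⟩ := hdiv (Submodule.Quotient.mk t)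
  obtain ⟨t', rfl⟩ := Submodule.Quotient.mk_surjective N q'
  rw [← Submodule.Quotient.mk_smul, Submodule.Quotient.eq] at hq'
  have ht : t = θ • t' - (θ • t' - t) := by abel
  rw [ht, map_sub, AddMonoidHom.sub_apply, hyN _ hq', sub_zero, hbal, hy, map_zero]

/-- The same with `IsDivisible Λ (H ⧸ N)` (every nonzero `θ`) and `θ ≠ 0`.
[cite: Greenberg2010, §2.3 p. 13 L36–38 (proof of Prop. 2.3.2)] -/
theorem IsDivisible.eq_zero_of_orthogonal_of_endo_eq_zero (P : H →+ Y →+ C)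
    (hperf : ∀ y : Y, (∀ t : H, P t y = 0) → y = 0) {θ : Λ} (hθ : θ ≠ 0) (e : Y →+ Y)
    (hbal : ∀ (t : H) (y : Y), P (θ • t) y = P t (e y)) (N : Submodule Λ H)
    (hQ : IsDivisible Λ (H ⧸ N)) {y : Y} (hyN : ∀ n ∈ N, P n y = 0) (hy : e y = 0) : y = 0 :=
  eq_zero_of_orthogonal_of_endo_eq_zero_of_quotient_divisible P hperf θ e hbal N (hQ θ hθ) hyN hy

/-- Degenerate case used for `Ш¹`: `y` orthogonal to EVERYTHING is zero (right-perfectness, restated),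
so Prop. 2.1.1's local step needs no divisibility. [cite: Greenberg2010, §2.1 p. 8 L8–12 (proof of Prop. 2.1.1)] -/
theorem eq_zero_of_forall_pairing_eq_zero (P : H →+ Y →+ C)
    (hperf : ∀ y : Y, (∀ t : H, P t y = 0) → y = 0) {y : Y} (hy : ∀ t : H, P t y = 0) : y = 0 :=
  hperf y hy

end Pairing

end Literature.NumberTheory.IwasawaTheory.Greenberg2016

end
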